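import Summits.QuantumFields.YangMills.Theorems.BalabanUVNodesK3V5Stub1LetterForm

/-!
# K3⁷ v5 — STUB 2's TEXT BY NAME ⟺ ITS READING-FREE LETTER FORM; the two-stub composition of the item KEYED ON LETTERS

Cell `pub-ymgap` (HUMAN RULING D-0062 Track A; director-ym №197 ∕ HUMAN RULING D-0149), WIDTH SEAT `pub-ymgap-dag-n27-w1` (gen 3) on NODE n27 (B5 composite).
`--kind proof --supports stmt-QuantumFields-20544 --as helper` (count-neutral).  THEOREMS ONLY, 0 `def`, 0 `sorry`, standard axioms; `N = 2` (= the stub texts).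
Sequel of `Thm/BalabanUVNodesK3V5Stub1LetterForm.lean` (p608315: the all-pins reading minted, `GuardedReading ↔ pins`, STUB 1's text ⟺ its letter form).

K3⁷ v5 (skeleton 941dddb108cbaacf) registers TWO stub texts; stub 2 is
`stub_expansion13H : ∀ β, 2/3 < β → β < 1 → ∀ 𝔯 ksel ℓ ℓ₃ g B, GuardedReadingN16 𝔯 ksel ℓ ℓ₃ g B → KeyedRatesHolderD4 β (rrOfRecord 𝔯 ksel) →
  ∃ jc sh cr, PinnedAtLive jc sh cr ∧ KeyedRelWeight cr ∧ KeyedShellWeight cr ∧ KeyedExtraction cr ∧ KeyedCoreEdgeHolderD4 β cr (rrOfRecord 𝔯 ksel)`.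
The reading `𝔯` enters stub 2 ONLY through `GuardedReadingN16` (= the four pins ∧ node N16's two letter rows, p608315 `guardedReadingN16_iff_pins_letterRows`) and through the
bundle `rrOfRecord 𝔯 ksel`, which under the pins IS the spelled bundle of letters (p608315 `rrOfRecord_eq_of_pins`).  THIS FILE records the consequence:

* §1 `exists_reading_v5pins_rrOfRecord_eq` — the minted all-pins reading's bundle at EVERY selector IS the spelled bundle of its letters (`rfl`), pins included.
* §2 ★★★ `stub2Text_iff_letterForm` — STUB 2's TEXT ⟺ «for every `β ∈ ]2/3,1[`, every letter tuple (`0 < l₀`, `0 ≤ Λ`, `0 < b`, `0 < a_S`, directions, `c₃₅`, `p`, `ℓ`, `ℓ₃`,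
  `g`, `B`) carrying node N16's two letter rows, every run-length selector: `KeyedRatesHolderD4 β` at the spelled bundle of letters ⟹ SOME cut policy `jc`, shell split `sh`
  and spine reading `cr` with `PinnedAtLive jc sh cr ∧ KeyedRelWeight cr ∧ KeyedShellWeight cr ∧ KeyedExtraction cr ∧ KeyedCoreEdgeHolderD4 β cr` (spelled bundle)» — no
  rate reading, no guard in the statement.
* §3 `spineGivenEndpointR13SepCoPH_of_letterForms` — THE ITEM BY NAME from the two LETTER FORMS (= v5's composition `stub 1 → stub 2 → K3⁷` re-keyed on letters: gen-2's
  `spineGivenEndpointR13SepCoPH_of_stubTexts` ∘ the two `iff`s); `spineGivenEndpointR13SepCoPH_of_rows_of_stub2LetterForm` — THE ITEM from p608315 §4's rows (`h16` + def-W1's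
  four kernel letters + U3 rows + the two N16 rows) and stub 2's LETTER FORM.
LOCATED CONSEQUENCE (for the plan, not a re-cut ask): both registered stub texts have kernel-certified reading-free normal forms; the `∃ 𝔯 ∕ ∀ 𝔯`, `ksel`-as-function and
`GuardedReading[N16]` layers of v5 carry exactly «letters + node N16's two rows + the run length read»; a later edition may key both stubs on the letter tuple.

HONEST FRAMING.  COMPOSITE-node bookkeeping BY NAME (`Iff`s, one minted reading, compositions); NOT a proof of `stub_rates13H` or `stub_expansion13H`; every estimate
(THE END's N16 sentence, def-W1's finite-volume kernel letters NOT PRINTED as such for d = 4, (5.10) for the limiting kernels = print's claim [Balaban1987RG1] p.293, NE7b ∕ NE7c ∕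
the NE7 core edge ∕ N27x extraction at the spine reading of record) is a DISPLAYED HYPOTHESIS or sits inside the two letter forms, inhabited for no family today (K0⁷ OPEN); the
minted reading's N14 ∕ N15 components are dag-n14-w1's datum-read tower ∕ dag-n15-a's MODEL-level family (v5's labels); nothing of Bałaban's asserted or instantiated; N14–N22 ∕ N27
NOT discharged; K3⁷ stmt-QuantumFields-20544 OPEN, NOT claimed; skeleton v5 UNTOUCHED (plan's); counts UNMOVED (typed 28∕28 · discharged 5∕27, A 5∕28).  One finite 𝕋⁴
programme at fixed `ε` — R4 closes the CONDITIONAL finite-𝕋⁴ rung `BalabanLadder.UV` only: NOT continuum ∕ ℝ⁴ ∕ OS ∕ mass gap ∕ Clay; the Yang–Mills mass gap is NOT proved by any of this.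
-/

set_option autoImplicit false

noncomputable section

open scoped Matrix.Norms.L2Operator

namespace Summit.QuantumFields.YangMills.Theorems.K3V5Defs

open Literature.MathematicalPhysics.QuantumFieldTheory.Balaban1983to89
open Literature.MathematicalPhysics.QuantumFieldTheory.Balaban1983to89.T4Continuum
open Literature.MathematicalPhysics.QuantumFieldTheory.Balaban1983to89.B12Sec2to5 (betaPrime510)
open Literature.MathematicalPhysics.QuantumFieldTheory.Balaban1983to89.Node00.U3OfKernels (objectsOfRecord₁₃)
open Literature.MathematicalPhysics.QuantumFieldTheory.Balaban1983to89.Node00.U3KernelLetters (PolLimitsExistOfRecord₁₃ WindowedNE9OfRecord₁₃ WindowedDecayOfRecord₁₃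
  WindowedStepRateOfRecord₁₃)
open Summit.QuantumFields.BalabanUV.T4Continuum
open Summit.QuantumFields.BalabanUV.T4Continuum.Spine
open MinimalActionRate (sfClass)
open YMDAG.UVSplit
open YMDAG.N14.TopBorn (Ne1PinnedOfRecord ne1OfRecord)
open Node00 (Stage13HParams U3Letters₁₁ NE3Letters₁₁ NE3Objects₁₁ RateObjects₁₁ ne3ConstLayerOfRecord₁₁ ne3NperOfRecord₁₁ ne3DomOfRecord₁₁)
open Summit.QuantumFields.YangMills.BalabanUVNodes.N16HolderDefs (N16HolderAt)
open Summit.QuantumFields.YangMills.BalabanUVNodes.N16PinnedLayer13CoPH (N16PinnedLoose N16LettersEnd)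
open Summit.QuantumFields.YangMills.BalabanUVNodes.N15.GenuineRecord (fullGSizedObjects)
open Summit.QuantumFields.YangMills.BalabanUVNodes.N15.AtKeyedHome (neZero_blockFactor)

/-! ## §1 The minted reading's bundle IS the spelled bundle of its letters, at every selector -/

/-- ★ **THE ALL-PINS READING, WITH ITS BUNDLE SPELLED**: for every letter choice SOME reading carries the four v5 pins AND its bundle of record at EVERY selector `ksel` is,
by `rfl`, the spelled bundle `⟨ne1OfRecord l₀ Λ …, ne2OfRecord₁₁ (fullGSizedObjects 3 F.hL b a_S …), ne3OfRecord₁₁ F (loose layer ℓ₃ B), u3OfRecord₁₃ θ (objectsOfRecord₁₃ F 2 θ (ℓ F θ)) (ksel …)⟩`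
(p608315's witness, equation added). [bookkeeping] -/
theorem exists_reading_v5pins_rrOfRecord_eq (l₀ Λ b aS : ℝ) (ν μ α β' : Fin 4) (c35 p : ℝ) (ℓ : LetterReading) (ℓ₃ : T4Family → NE3Letters₁₁) (B : T4Family → ℝ)
    (hl₀ : 0 < l₀) (hΛ : 0 ≤ Λ) (hb : 0 < b) (haS : 0 < aS) :
    ∃ 𝔯 : RateReading₁₃CoPH 2, (Ne1PinnedOfRecord 𝔯 ∧ N15PinnedSized 𝔯 ∧ U3PinnedKernels 𝔯 ℓ ∧ N16PinnedLoose 𝔯 ℓ₃ B) ∧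
      ∀ ksel : RunSel, rrOfRecord 𝔯 ksel = fun F θ hP g₀ os =>
        ⟨ne1OfRecord l₀ Λ F θ hP g₀ os, ne2OfRecord₁₁ (haveI := neZero_blockFactor F; fullGSizedObjects 3 F.hL b aS ν μ α β' c35 p),
          ne3OfRecord₁₁ F { ne3ConstLayerOfRecord₁₁ F 2 (ℓ₃ F) with
            dom := {V | V ∈ ne3DomOfRecord₁₁ F 2 0 0 ∧ V ∈ sfClass 4 F.L (ne3NperOfRecord₁₁ F 0 0) ((ℓ₃ F).ε / B F) 0} },
          u3OfRecord₁₃ θ.toStage13Params (objectsOfRecord₁₃ F 2 θ.toStage13Params (ℓ F θ)) (ksel F θ hP g₀ os)⟩ := by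
  let lit : (F : T4Family) → (θ : Stage13HParams F 2) → θ.Provisos₁₃CoPH F 2 → (ℕ → ℝ) → List (ULoop F) → RateObjects₁₁ 2 :=
    fun F θ _ _ _ =>
      ⟨objectsOfRecord₁₃ F 2 θ.toStage13Params (ℓ F θ),
        fun _ => { ne3ConstLayerOfRecord₁₁ F 2 (ℓ₃ F) with
          dom := {V | V ∈ ne3DomOfRecord₁₁ F 2 0 0 ∧ V ∈ sfClass 4 F.L (ne3NperOfRecord₁₁ F 0 0) ((ℓ₃ F).ε / B F) 0} },
        fun _ => haveI := neZero_blockFactor F; fullGSizedObjects 3 F.hL b aS ν μ α β' c35 p⟩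
  exact ⟨⟨lit, ne1OfRecord l₀ Λ⟩, ⟨⟨l₀, Λ, hl₀, hΛ, fun _ _ _ _ _ => rfl⟩, ⟨b, aS, ν, μ, α, β', c35, p, hb, haS, fun _ _ _ _ _ _ => rfl⟩,
    fun _ _ _ _ _ => rfl, fun _ _ _ _ _ _ => rfl⟩, fun _ => rfl⟩

/-- **UNDER `GuardedReadingN16` THE BUNDLE IS A BUNDLE OF LETTERS**: the guarded reading's letters `l₀ Λ b a_S …` (read off its N14 ∕ N15 pins) with their positivity rows, such that
`rrOfRecord 𝔯 ksel` IS the spelled bundle at EVERY selector (p608315 `guardedReadingN16_iff_pins_letterRows` + `rrOfRecord_eq_of_pins`, `funext`). [bookkeeping] -/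
theorem exists_letters_rrOfRecord_eq_of_guardedReadingN16 {𝔯 : RateReading₁₃CoPH 2} {ksel : RunSel} {ℓ : LetterReading} {ℓ₃ : T4Family → NE3Letters₁₁} {g B : T4Family → ℝ}
    (hG : GuardedReadingN16 𝔯 ksel ℓ ℓ₃ g B) :
    ∃ (l₀ Λ b aS : ℝ) (ν μ α β' : Fin 4) (c35 p : ℝ), 0 < l₀ ∧ 0 ≤ Λ ∧ 0 < b ∧ 0 < aS ∧
      ∀ ksel' : RunSel, rrOfRecord 𝔯 ksel' = fun F θ hP g₀ os =>
        ⟨ne1OfRecord l₀ Λ F θ hP g₀ os, ne2OfRecord₁₁ (haveI := neZero_blockFactor F; fullGSizedObjects 3 F.hL b aS ν μ α β' c35 p),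
          ne3OfRecord₁₁ F { ne3ConstLayerOfRecord₁₁ F 2 (ℓ₃ F) with
            dom := {V | V ∈ ne3DomOfRecord₁₁ F 2 0 0 ∧ V ∈ sfClass 4 F.L (ne3NperOfRecord₁₁ F 0 0) ((ℓ₃ F).ε / B F) 0} },
          u3OfRecord₁₃ θ.toStage13Params (objectsOfRecord₁₃ F 2 θ.toStage13Params (ℓ F θ)) (ksel' F θ hP g₀ os)⟩ := by
  obtain ⟨⟨⟨l₀, Λ, hl₀, hΛ, h1⟩, ⟨b, aS, ν, μ, α, β', c35, p, hb, haS, h2⟩, h3, hL⟩, -, -⟩ := (guardedReadingN16_iff_pins_letterRows ksel ℓ ℓ₃ g B).1 hG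
  exact ⟨l₀, Λ, b, aS, ν, μ, α, β', c35, p, hl₀, hΛ, hb, haS, fun ksel' => funext fun F => funext fun θ => funext fun hP => funext fun g₀ => funext fun os =>
    rrOfRecord_eq_of_pins h1 h2 h3 hL ksel' F θ hP g₀ os⟩

/-! ## §2 STUB 2's TEXT ⟺ its reading-free letter form -/

/-- ★★★ **STUB 2's TEXT ⟺ ITS LETTER FORM.**  K3⁷ v5's `stub_expansion13H` text (left, VERBATIM over the mirrored names) holds iff: for every `β ∈ ]2/3, 1[`, every letter tuple
(`0 < l₀`, `0 ≤ Λ`, `0 < b`, `0 < a_S`, directions `ν μ α β′`, `c₃₅`, `p`, letter-block reading `ℓ`, N16 letters `ℓ₃`, coupling letter `g`, radius letter `B`) carrying node N16's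
two letter rows `N16LettersEnd 2 g ℓ₃ ∧ N16RadiusMatch ℓ₃ B`, and every run-length selector `ksel`, the FSC-keyed rates `KeyedRatesHolderD4 β` AT THE SPELLED BUNDLE OF LETTERS
imply SOME per-tuple cut policy `jc`, shell split `sh` and spine reading `cr` pinned at live (`PinnedAtLive jc sh cr`) carrying N20 ∕ N21 ∕ N27x and the N19′ core edge
`KeyedCoreEdgeHolderD4 β cr` AT THE SAME SPELLED BUNDLE.  «⇒»: mint the all-pins reading of the letters (§1), its bundle IS the spelled one; «⇐»: a guarded reading's bundle is a
bundle of letters (`exists_letters_rrOfRecord_eq_of_guardedReadingN16`).  What stub 2 asserts, with no rate reading and no guard in the statement. [bookkeeping] -/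
theorem stub2Text_iff_letterForm :
    (∀ β : ℝ, 2 / 3 < β → β < 1 →
      ∀ (𝔯 : RateReading₁₃CoPH 2) (ksel : RunSel) (ℓ : LetterReading) (ℓ₃ : T4Family → Node00.NE3Letters₁₁) (g B : T4Family → ℝ),
        GuardedReadingN16 𝔯 ksel ℓ ℓ₃ g B → KeyedRatesHolderD4 β (rrOfRecord 𝔯 ksel) →
        ∃ (jc : CutReading) (sh : ShellSplit₁₃CoPH 2 0) (cr : SpineReading), PinnedAtLive jc sh cr ∧
          KeyedRelWeight cr ∧ KeyedShellWeight cr ∧ KeyedExtraction cr ∧ KeyedCoreEdgeHolderD4 β cr (rrOfRecord 𝔯 ksel)) ↔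
    ∀ β : ℝ, 2 / 3 < β → β < 1 →
      ∀ (l₀ Λ b aS : ℝ) (ν μ α β' : Fin 4) (c35 p : ℝ) (ℓ : LetterReading) (ℓ₃ : T4Family → NE3Letters₁₁) (g B : T4Family → ℝ) (ksel : RunSel),
        0 < l₀ → 0 ≤ Λ → 0 < b → 0 < aS → N16LettersEnd 2 g ℓ₃ → N16RadiusMatch ℓ₃ B →
        (KeyedRatesHolderD4 β fun F θ hP g₀ os =>
          ⟨ne1OfRecord l₀ Λ F θ hP g₀ os, ne2OfRecord₁₁ (haveI := neZero_blockFactor F; fullGSizedObjects 3 F.hL b aS ν μ α β' c35 p),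
            ne3OfRecord₁₁ F { ne3ConstLayerOfRecord₁₁ F 2 (ℓ₃ F) with
              dom := {V | V ∈ ne3DomOfRecord₁₁ F 2 0 0 ∧ V ∈ sfClass 4 F.L (ne3NperOfRecord₁₁ F 0 0) ((ℓ₃ F).ε / B F) 0} },
            u3OfRecord₁₃ θ.toStage13Params (objectsOfRecord₁₃ F 2 θ.toStage13Params (ℓ F θ)) (ksel F θ hP g₀ os)⟩) →
        ∃ (jc : CutReading) (sh : ShellSplit₁₃CoPH 2 0) (cr : SpineReading), PinnedAtLive jc sh cr ∧
          KeyedRelWeight cr ∧ KeyedShellWeight cr ∧ KeyedExtraction cr ∧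
          KeyedCoreEdgeHolderD4 β cr fun F θ hP g₀ os =>
            ⟨ne1OfRecord l₀ Λ F θ hP g₀ os, ne2OfRecord₁₁ (haveI := neZero_blockFactor F; fullGSizedObjects 3 F.hL b aS ν μ α β' c35 p),
              ne3OfRecord₁₁ F { ne3ConstLayerOfRecord₁₁ F 2 (ℓ₃ F) with
                dom := {V | V ∈ ne3DomOfRecord₁₁ F 2 0 0 ∧ V ∈ sfClass 4 F.L (ne3NperOfRecord₁₁ F 0 0) ((ℓ₃ F).ε / B F) 0} },
              u3OfRecord₁₃ θ.toStage13Params (objectsOfRecord₁₃ F 2 θ.toStage13Params (ℓ F θ)) (ksel F θ hP g₀ os)⟩ := by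
  constructor
  · intro H β hβ hβ' l₀ Λ b aS ν μ α β' c35 p ℓ ℓ₃ g B ksel hl₀ hΛ hb haS hE hM hK
    obtain ⟨𝔯, hpins, hrr⟩ := exists_reading_v5pins_rrOfRecord_eq l₀ Λ b aS ν μ α β' c35 p ℓ ℓ₃ B hl₀ hΛ hb haS
    have hG : GuardedReadingN16 𝔯 ksel ℓ ℓ₃ g B := (guardedReadingN16_iff_pins_letterRows ksel ℓ ℓ₃ g B).2 ⟨hpins, hE, hM⟩
    have h := H β hβ hβ' 𝔯 ksel ℓ ℓ₃ g B hG ((hrr ksel).symm ▸ hK)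
    rw [hrr ksel] at h
    exact h
  · intro H β hβ hβ' 𝔯 ksel ℓ ℓ₃ g B hG hK
    obtain ⟨l₀, Λ, b, aS, ν, μ, α, β', c35, p, hl₀, hΛ, hb, haS, hrr⟩ := exists_letters_rrOfRecord_eq_of_guardedReadingN16 hG
    have h := H β hβ hβ' l₀ Λ b aS ν μ α β' c35 p ℓ ℓ₃ g B ksel hl₀ hΛ hb haS hG.2.2.1 hG.2.2.2 ((hrr ksel) ▸ hK)
    rw [← hrr ksel] at h
    exact h

/-! ## §3 The item keyed on letters -/

/-- **K3⁷ BY NAME FROM THE TWO LETTER FORMS** (v5's composition `stub 1 → stub 2 → K3⁷` re-keyed on the letter tuple: p608315 `stub1Text_iff_letterForm` and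
`stub2Text_iff_letterForm` feed gen-2's `spineGivenEndpointR13SepCoPH_of_stubTexts`).  NOT a proof of either stub; every estimate sits inside the two hypotheses. [bookkeeping] -/
theorem spineGivenEndpointR13SepCoPH_of_letterForms
    (h₁ : ∃ β : ℝ, 2 / 3 < β ∧ β < 1 ∧
      ∃ (l₀ Λ b aS : ℝ) (ν μ α β' : Fin 4) (c35 p : ℝ) (ℓ : LetterReading) (ℓ₃ : T4Family → NE3Letters₁₁) (g B : T4Family → ℝ) (ksel : RunSel),
        0 < l₀ ∧ 0 ≤ Λ ∧ 0 < b ∧ 0 < aS ∧ N16LettersEnd 2 g ℓ₃ ∧ N16RadiusMatch ℓ₃ B ∧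
        KeyedRatesHolderD4 β fun F θ hP g₀ os =>
          ⟨ne1OfRecord l₀ Λ F θ hP g₀ os, ne2OfRecord₁₁ (haveI := neZero_blockFactor F; fullGSizedObjects 3 F.hL b aS ν μ α β' c35 p),
            ne3OfRecord₁₁ F { ne3ConstLayerOfRecord₁₁ F 2 (ℓ₃ F) with
              dom := {V | V ∈ ne3DomOfRecord₁₁ F 2 0 0 ∧ V ∈ sfClass 4 F.L (ne3NperOfRecord₁₁ F 0 0) ((ℓ₃ F).ε / B F) 0} },
            u3OfRecord₁₃ θ.toStage13Params (objectsOfRecord₁₃ F 2 θ.toStage13Params (ℓ F θ)) (ksel F θ hP g₀ os)⟩)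
    (h₂ : ∀ β : ℝ, 2 / 3 < β → β < 1 →
      ∀ (l₀ Λ b aS : ℝ) (ν μ α β' : Fin 4) (c35 p : ℝ) (ℓ : LetterReading) (ℓ₃ : T4Family → NE3Letters₁₁) (g B : T4Family → ℝ) (ksel : RunSel),
        0 < l₀ → 0 ≤ Λ → 0 < b → 0 < aS → N16LettersEnd 2 g ℓ₃ → N16RadiusMatch ℓ₃ B →
        (KeyedRatesHolderD4 β fun F θ hP g₀ os =>
          ⟨ne1OfRecord l₀ Λ F θ hP g₀ os, ne2OfRecord₁₁ (haveI := neZero_blockFactor F; fullGSizedObjects 3 F.hL b aS ν μ α β' c35 p),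
            ne3OfRecord₁₁ F { ne3ConstLayerOfRecord₁₁ F 2 (ℓ₃ F) with
              dom := {V | V ∈ ne3DomOfRecord₁₁ F 2 0 0 ∧ V ∈ sfClass 4 F.L (ne3NperOfRecord₁₁ F 0 0) ((ℓ₃ F).ε / B F) 0} },
            u3OfRecord₁₃ θ.toStage13Params (objectsOfRecord₁₃ F 2 θ.toStage13Params (ℓ F θ)) (ksel F θ hP g₀ os)⟩) →
        ∃ (jc : CutReading) (sh : ShellSplit₁₃CoPH 2 0) (cr : SpineReading), PinnedAtLive jc sh cr ∧
          KeyedRelWeight cr ∧ KeyedShellWeight cr ∧ KeyedExtraction cr ∧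
          KeyedCoreEdgeHolderD4 β cr fun F θ hP g₀ os =>
            ⟨ne1OfRecord l₀ Λ F θ hP g₀ os, ne2OfRecord₁₁ (haveI := neZero_blockFactor F; fullGSizedObjects 3 F.hL b aS ν μ α β' c35 p),
              ne3OfRecord₁₁ F { ne3ConstLayerOfRecord₁₁ F 2 (ℓ₃ F) with
                dom := {V | V ∈ ne3DomOfRecord₁₁ F 2 0 0 ∧ V ∈ sfClass 4 F.L (ne3NperOfRecord₁₁ F 0 0) ((ℓ₃ F).ε / B F) 0} },
              u3OfRecord₁₃ θ.toStage13Params (objectsOfRecord₁₃ F 2 θ.toStage13Params (ℓ F θ)) (ksel F θ hP g₀ os)⟩) :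
    Summit.QuantumFields.YangMills.Theses.BalabanUVNodes.SpineGivenEndpointR13SepCoPH :=
  spineGivenEndpointR13SepCoPH_of_stubTexts (stub1Text_iff_letterForm.2 h₁) (stub2Text_iff_letterForm.2 h₂)

section Rows

variable (β : ℝ) (hβ : 2 / 3 < β) (hβ' : β < 1) (ℓ : LetterReading) (ℓ₃ : T4Family → Node00.NE3Letters₁₁) (g B : T4Family → ℝ)
  (s : (F : T4Family) → Stage13HParams F 2 → ℕ)
  (hE : N16LettersEnd 2 g ℓ₃) (hM : N16RadiusMatch ℓ₃ B)
  (hs : ∀ (F : T4Family) (θ : Stage13HParams F 2), θ.Provisos₁₃CoPH F 2 → (θ.ZhUnity F 2 ∧ θ.SlotsNondegenerate₁₃ F 2) → θ.Admissible F 2 → (ℓ F θ).Signs)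
  (hκ : ∀ (F : T4Family) (θ : Stage13HParams F 2), θ.Provisos₁₃CoPH F 2 → (θ.ZhUnity F 2 ∧ θ.SlotsNondegenerate₁₃ F 2) → θ.Admissible F 2 → 0 < (ℓ F θ).κ)
  (hcr : ∀ (F : T4Family) (θ : Stage13HParams F 2), θ.Provisos₁₃CoPH F 2 → (θ.ZhUnity F 2 ∧ θ.SlotsNondegenerate₁₃ F 2) → θ.Admissible F 2 → betaPrime510 4 1 (ℓ F θ).κ ≤ (ℓ F θ).cr)
  (hρ : ∀ (F : T4Family) (θ : Stage13HParams F 2), θ.Provisos₁₃CoPH F 2 → (θ.ZhUnity F 2 ∧ θ.SlotsNondegenerate₁₃ F 2) → θ.Admissible F 2 → 0 ≤ (ℓ F θ).ρ ∧ (ℓ F θ).ρ < 1)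
  (hL : ∀ (F : T4Family) (θ : Stage13HParams F 2), θ.Provisos₁₃CoPH F 2 → (θ.ZhUnity F 2 ∧ θ.SlotsNondegenerate₁₃ F 2) → θ.Admissible F 2 → PolLimitsExistOfRecord₁₃ F 2 θ.toStage13Params)
  (h9 : ∀ (F : T4Family) (θ : Stage13HParams F 2), θ.Provisos₁₃CoPH F 2 → (θ.ZhUnity F 2 ∧ θ.SlotsNondegenerate₁₃ F 2) → θ.Admissible F 2 →
    WindowedNE9OfRecord₁₃ F 2 θ.toStage13Params (ℓ F θ).κ (ℓ F θ).moduli)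
  (hW : ∀ (F : T4Family) (θ : Stage13HParams F 2), θ.Provisos₁₃CoPH F 2 → (θ.ZhUnity F 2 ∧ θ.SlotsNondegenerate₁₃ F 2) → θ.Admissible F 2 →
    WindowedDecayOfRecord₁₃ F 2 θ.toStage13Params 0 1 (ℓ F θ).κ)
  (hS : ∀ (F : T4Family) (θ : Stage13HParams F 2), θ.Provisos₁₃CoPH F 2 → (θ.ZhUnity F 2 ∧ θ.SlotsNondegenerate₁₃ F 2) → θ.Admissible F 2 →
    WindowedStepRateOfRecord₁₃ F 2 θ.toStage13Params (s F θ) (ℓ F θ).κ (ℓ F θ).θ₅ ((ℓ F θ).C₅ * (ℓ F θ).θ₅))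
include hβ hβ' hE hM hs hκ hcr hρ hL h9 hW hS

/-- **K3⁷ BY NAME FROM STUB 1's ROWS AND STUB 2's LETTER FORM** (p608315 `stub1Text_of_rows` + `stub2Text_iff_letterForm` + gen-2's composition): the item costs exactly `h16` +
def-W1's four kernel letters + the U3 rows + node N16's two rows (stub 1's side) and stub 2's reading-free letter form.  Every row a HYPOTHESIS; NOT a proof of either stub. [bookkeeping] -/
theorem spineGivenEndpointR13SepCoPH_of_rows_of_stub2LetterForm
    (h16 : ∀ (F : T4Family), (∃ θ : Stage13HParams F 2, θ.Provisos₁₃CoPH F 2 ∧ (θ.ZhUnity F 2 ∧ θ.SlotsNondegenerate₁₃ F 2) ∧ θ.Admissible F 2) →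
      N16HolderAt (ne3OfRecord₁₁ F { ne3ConstLayerOfRecord₁₁ F 2 (ℓ₃ F) with
        dom := {V | V ∈ ne3DomOfRecord₁₁ F 2 0 0 ∧ V ∈ sfClass 4 F.L (ne3NperOfRecord₁₁ F 0 0) ((ℓ₃ F).ε / B F) 0} }) β)
    (h₂ : ∀ β : ℝ, 2 / 3 < β → β < 1 →
      ∀ (l₀ Λ b aS : ℝ) (ν μ α β' : Fin 4) (c35 p : ℝ) (ℓ : LetterReading) (ℓ₃ : T4Family → NE3Letters₁₁) (g B : T4Family → ℝ) (ksel : RunSel),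
        0 < l₀ → 0 ≤ Λ → 0 < b → 0 < aS → N16LettersEnd 2 g ℓ₃ → N16RadiusMatch ℓ₃ B →
        (KeyedRatesHolderD4 β fun F θ hP g₀ os =>
          ⟨ne1OfRecord l₀ Λ F θ hP g₀ os, ne2OfRecord₁₁ (haveI := neZero_blockFactor F; fullGSizedObjects 3 F.hL b aS ν μ α β' c35 p),
            ne3OfRecord₁₁ F { ne3ConstLayerOfRecord₁₁ F 2 (ℓ₃ F) with
              dom := {V | V ∈ ne3DomOfRecord₁₁ F 2 0 0 ∧ V ∈ sfClass 4 F.L (ne3NperOfRecord₁₁ F 0 0) ((ℓ₃ F).ε / B F) 0} },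
            u3OfRecord₁₃ θ.toStage13Params (objectsOfRecord₁₃ F 2 θ.toStage13Params (ℓ F θ)) (ksel F θ hP g₀ os)⟩) →
        ∃ (jc : CutReading) (sh : ShellSplit₁₃CoPH 2 0) (cr : SpineReading), PinnedAtLive jc sh cr ∧
          KeyedRelWeight cr ∧ KeyedShellWeight cr ∧ KeyedExtraction cr ∧
          KeyedCoreEdgeHolderD4 β cr fun F θ hP g₀ os =>
            ⟨ne1OfRecord l₀ Λ F θ hP g₀ os, ne2OfRecord₁₁ (haveI := neZero_blockFactor F; fullGSizedObjects 3 F.hL b aS ν μ α β' c35 p),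
              ne3OfRecord₁₁ F { ne3ConstLayerOfRecord₁₁ F 2 (ℓ₃ F) with
                dom := {V | V ∈ ne3DomOfRecord₁₁ F 2 0 0 ∧ V ∈ sfClass 4 F.L (ne3NperOfRecord₁₁ F 0 0) ((ℓ₃ F).ε / B F) 0} },
              u3OfRecord₁₃ θ.toStage13Params (objectsOfRecord₁₃ F 2 θ.toStage13Params (ℓ F θ)) (ksel F θ hP g₀ os)⟩) :
    Summit.QuantumFields.YangMills.Theses.BalabanUVNodes.SpineGivenEndpointR13SepCoPH :=
  spineGivenEndpointR13SepCoPH_of_stubTexts (stub1Text_of_rows β hβ hβ' ℓ ℓ₃ g B s hE hM hs hκ hcr hρ hL h9 hW hS h16) (stub2Text_iff_letterForm.2 h₂)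

end Rows

end Summit.QuantumFields.YangMills.Theorems.K3V5Defs

end
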